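import Summits.Ventures.HodgeRepro2.T5SU11LegendreSecondKind
import Summits.Ventures.HodgeRepro2.T5SU11LegendreCoefficientDecay
import Mathlib.Analysis.Calculus.ParametricIntervalIntegral

/-!
# The Legendre functions of the second kind solve Legendre's equation:
`(1 − x²) Q″_n − 2x Q′_n + n(n + 1) Q_n = 0` for `x > 1`

Differentiating Neumann's integral `Q_n(x) = ½ ∫_{−1}^{1} P_n(t)/(x − t) dt` under the integral sign (Mathlib's
`hasDerivAt_integral_of_dominated_loc_of_deriv_le`, on the neighbourhood `x > (x₀ + 1)/2` where `x − t ≥ (x₀ − 1)/2`)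
gives **`Q′_n(x) = −½ ∫ P_n(t)/(x − t)² dt`** and **`Q″_n(x) = ∫ P_n(t)/(x − t)³ dt`** (`hasDerivAt_legQ2`,
`hasDerivAt_legQ2'`). The Legendre operator in `x` applied to the kernel `u(t) = 1/(x − t)` equals the Legendre
operator in `t`: `2(1 − x²)/(x − t)³ + 2x/(x − t)² + n(n + 1)/(x − t) = (1 − t²) u″ − 2t u′ + n(n + 1) u`
(`kernel_identity`), and the Sturm–Liouville operator is symmetric against `P_n` (row 422's integration by parts,
`integral_mul_legP_eq_neg`: `n(n + 1) ∫ u P_n = −∫ ((1 − t²) u′)′ P_n`), so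

  **`(1 − x²) Q″_n(x) − 2x Q′_n(x) + n(n + 1) Q_n(x) = 0` for every `x > 1`**   (`legendre_ode_legQ2`):

`Q_n` is a second solution of Legendre's equation on `(1, ∞)`. Nothing is claimed about (N).

Blind lane: Mathlib + the HodgeRepro2 prefix only; no sorry; axioms ⊆ {propext, Classical.choice,
Quot.sound}.
-/

namespace Summit.Ventures.HodgeRepro2.T5SU11LegendreSecondKindODE

open Polynomial intervalIntegral Finset Filter Topology MeasureTheory
open Set (Icc Ioi Ioo uIcc uIoc)
open T5SU11SphericalLegendreAll T5SU11LegendreIdentities T5SU11LegendreBound T5SU11LegendreCoefficientDecay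
  T5SU11LegendreSecondKind

/-! ### The derivatives of Neumann's integral -/

/-- **`Q′_n(x) = −½ ∫_{−1}^{1} P_n(t)/(x − t)² dt`**, the first derivative of `Q_n` (meaningful for `x > 1`). -/
noncomputable def legQ2' (n : ℕ) (x : ℝ) : ℝ := -(1 / 2) * ∫ t in (-1 : ℝ)..1, legP n t / (x - t) ^ 2

/-- **`Q″_n(x) = ∫_{−1}^{1} P_n(t)/(x − t)³ dt`**, the second derivative of `Q_n` (meaningful for `x > 1`). -/
noncomputable def legQ2'' (n : ℕ) (x : ℝ) : ℝ := ∫ t in (-1 : ℝ)..1, legP n t / (x - t) ^ 3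

/-- The kernels `t ↦ g(t)/(x − t)^m` are continuous on `[−1, 1]` for `x > 1`. -/
theorem continuousOn_div_sub_pow {g : ℝ → ℝ} (hg : Continuous g) (m : ℕ) {x : ℝ} (hx : 1 < x) :
    ContinuousOn (fun t => g t / (x - t) ^ m) (Icc (-1 : ℝ) 1) := by
  refine hg.continuousOn.div ((continuous_const.sub continuous_id).pow m).continuousOn fun t ht => ?_
  have : t < x := lt_of_le_of_lt ht.2 hx
  exact pow_ne_zero _ (by linarith)

/-- The restricted-measure measurability of the kernels for `x > 1`. -/
theorem aestronglyMeasurable_div_sub_pow {g : ℝ → ℝ} (hg : Continuous g) (m : ℕ) {x : ℝ} (hx : 1 < x) :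
    AEStronglyMeasurable (fun t => g t / (x - t) ^ m) (volume.restrict (uIoc (-1 : ℝ) 1)) := by
  have hsub : uIoc (-1 : ℝ) 1 ⊆ Icc (-1 : ℝ) 1 := by
    rw [Set.uIoc_of_le (by norm_num)]
    exact Set.Ioc_subset_Icc_self
  exact ((continuousOn_div_sub_pow hg m hx).mono hsub).aestronglyMeasurable measurableSet_uIoc

/-- On the neighbourhood `x > (x₀ + 1)/2` of `x₀ > 1` and for `t ∈ [−1, 1]`, `x − t ≥ (x₀ − 1)/2 > 0`. -/
theorem sub_ge_of_mem {x₀ x t : ℝ} (hx : x ∈ Ioi ((x₀ + 1) / 2)) (ht : t ∈ Icc (-1 : ℝ) 1) :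
    (x₀ - 1) / 2 ≤ x - t := by
  have := hx.out
  linarith [ht.2]

/-- **`Q_n` is differentiable on `(1, ∞)` with derivative `Q′_n`** (differentiation under the integral sign). -/
theorem hasDerivAt_legQ2 (n : ℕ) {x₀ : ℝ} (hx₀ : 1 < x₀) : HasDerivAt (legQ2 n) (legQ2' n x₀) x₀ := by
  set δ := (x₀ - 1) / 2 with hδ
  have hδpos : 0 < δ := by rw [hδ]; linarith
  have hsub : uIoc (-1 : ℝ) 1 ⊆ Icc (-1 : ℝ) 1 := by
    rw [Set.uIoc_of_le (by norm_num)]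
    exact Set.Ioc_subset_Icc_self
  have hs : Ioi ((x₀ + 1) / 2) ∈ 𝓝 x₀ := Ioi_mem_nhds (by linarith)
  have key := intervalIntegral.hasDerivAt_integral_of_dominated_loc_of_deriv_le (μ := volume) (a := (-1 : ℝ))
    (b := 1) (F := fun x t => legP n t / (x - t)) (F' := fun x t => -(legP n t / (x - t) ^ 2)) (x₀ := x₀)
    (bound := fun _ => 1 / δ ^ 2) hs
    (Filter.eventually_of_mem (Ioi_mem_nhds hx₀) fun x hx => by
      simpa using aestronglyMeasurable_div_sub_pow (continuous_legP n) 1 hx.out)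
    (intervalIntegrable_div_sub (continuous_legP n) hx₀)
    ((aestronglyMeasurable_div_sub_pow (continuous_legP n) 2 hx₀).neg)
    (Filter.Eventually.of_forall fun t ht x hx => by
      have ht' : t ∈ Icc (-1 : ℝ) 1 := hsub ht
      have hxt : δ ≤ x - t := sub_ge_of_mem hx ht'
      rw [Real.norm_eq_abs, abs_neg, abs_div, abs_of_pos (pow_pos (lt_of_lt_of_le hδpos hxt) 2)]
      calc |legP n t| / (x - t) ^ 2 ≤ 1 / δ ^ 2 :=
            div_le_div₀ (by norm_num) (abs_legP_le_one n ht') (pow_pos hδpos 2)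
              (pow_le_pow_left₀ hδpos.le hxt 2))
    intervalIntegrable_const
    (Filter.Eventually.of_forall fun t ht x hx => by
      have ht' : t ∈ Icc (-1 : ℝ) 1 := hsub ht
      have hxt : x - t ≠ 0 := (lt_of_lt_of_le hδpos (sub_ge_of_mem hx ht')).ne'
      have h := (hasDerivAt_const x (legP n t)).fun_div ((hasDerivAt_id x).sub_const t) hxt
      refine h.congr_deriv ?_
      simp only [id]
      field_simp
      ring)
  have h := key.2.const_mul (1 / 2)
  refine h.congr_deriv ?_
  rw [legQ2', intervalIntegral.integral_neg]
  ring

/-- **`Q′_n` is differentiable on `(1, ∞)` with derivative `Q″_n`** (differentiation under the integral sign). -/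
theorem hasDerivAt_legQ2' (n : ℕ) {x₀ : ℝ} (hx₀ : 1 < x₀) : HasDerivAt (legQ2' n) (legQ2'' n x₀) x₀ := by
  set δ := (x₀ - 1) / 2 with hδ
  have hδpos : 0 < δ := by rw [hδ]; linarith
  have hsub : uIoc (-1 : ℝ) 1 ⊆ Icc (-1 : ℝ) 1 := by
    rw [Set.uIoc_of_le (by norm_num)]
    exact Set.Ioc_subset_Icc_self
  have hs : Ioi ((x₀ + 1) / 2) ∈ 𝓝 x₀ := Ioi_mem_nhds (by linarith)
  have key := intervalIntegral.hasDerivAt_integral_of_dominated_loc_of_deriv_le (μ := volume) (a := (-1 : ℝ))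
    (b := 1) (F := fun x t => legP n t / (x - t) ^ 2) (F' := fun x t => -(2 * (legP n t / (x - t) ^ 3)))
    (x₀ := x₀) (bound := fun _ => 2 / δ ^ 3) hs
    (Filter.eventually_of_mem (Ioi_mem_nhds hx₀) fun x hx =>
      aestronglyMeasurable_div_sub_pow (continuous_legP n) 2 hx.out)
    ((continuousOn_div_sub_pow (continuous_legP n) 2 hx₀).intervalIntegrable_of_Icc (by norm_num))
    (((aestronglyMeasurable_div_sub_pow (continuous_legP n) 3 hx₀).const_mul 2).neg)
    (Filter.Eventually.of_forall fun t ht x hx => by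
      have ht' : t ∈ Icc (-1 : ℝ) 1 := hsub ht
      have hxt : δ ≤ x - t := sub_ge_of_mem hx ht'
      have hpos : 0 < x - t := lt_of_lt_of_le hδpos hxt
      rw [Real.norm_eq_abs, abs_neg, abs_mul, abs_div, abs_of_pos (pow_pos hpos 3), abs_two]
      calc 2 * (|legP n t| / (x - t) ^ 3) ≤ 2 * (1 / δ ^ 3) := by
            refine mul_le_mul_of_nonneg_left ?_ (by norm_num)
            exact div_le_div₀ (by norm_num) (abs_legP_le_one n ht') (pow_pos hδpos 3)
              (pow_le_pow_left₀ hδpos.le hxt 3)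
        _ = 2 / δ ^ 3 := by ring)
    intervalIntegrable_const
    (Filter.Eventually.of_forall fun t ht x hx => by
      have ht' : t ∈ Icc (-1 : ℝ) 1 := hsub ht
      have hxt : x - t ≠ 0 := (lt_of_lt_of_le hδpos (sub_ge_of_mem hx ht')).ne'
      have h := (hasDerivAt_const x (legP n t)).fun_div (((hasDerivAt_id x).sub_const t).pow 2)
        (pow_ne_zero 2 hxt)
      refine h.congr_deriv ?_
      simp only [id, Pi.pow_apply]
      field_simp
      ring)
  have h := key.2.const_mul (-(1 / 2))
  refine h.congr_deriv ?_
  rw [legQ2'', intervalIntegral.integral_neg, intervalIntegral.integral_const_mul]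
  ring

/-! ### The kernel identity and the equation -/

/-- The kernel `u(t) = 1/(x − t)` has `u′ = 1/(x − t)²` in `t` (for `t ≠ x`). -/
theorem hasDerivAt_kernel {x t : ℝ} (h : x - t ≠ 0) :
    HasDerivAt (fun t => 1 / (x - t)) (1 / (x - t) ^ 2) t := by
  have hd := (hasDerivAt_const t x).sub (hasDerivAt_id t)
  have := (hasDerivAt_const t (1 : ℝ)).fun_div hd h
  refine this.congr_deriv ?_
  simp only [Pi.sub_apply, id]
  field_simp
  ring

/-- The kernel `u(t) = 1/(x − t)` has `u″ = 2/(x − t)³` in `t` (for `t ≠ x`). -/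
theorem hasDerivAt_kernel' {x t : ℝ} (h : x - t ≠ 0) :
    HasDerivAt (fun t => 1 / (x - t) ^ 2) (2 / (x - t) ^ 3) t := by
  have hd := ((hasDerivAt_const t x).sub (hasDerivAt_id t)).pow 2
  have := (hasDerivAt_const t (1 : ℝ)).fun_div hd (pow_ne_zero 2 h)
  refine this.congr_deriv ?_
  simp only [Pi.pow_apply, Pi.sub_apply, id]
  field_simp
  ring

/-- **The kernel identity**: the Legendre operator in `x` on `1/(x − t)` equals the Sturm–Liouville form in `t`:
`2(1 − x²)/(x − t)³ + 2x/(x − t)² = (1 − t²) · 2/(x − t)³ − 2t · 1/(x − t)²` (for `t ≠ x`). -/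
theorem kernel_identity {x t : ℝ} (h : x - t ≠ 0) :
    (1 - x ^ 2) * (2 / (x - t) ^ 3) + 2 * x * (1 / (x - t) ^ 2)
      = (1 - t ^ 2) * (2 / (x - t) ^ 3) - 2 * t * (1 / (x - t) ^ 2) := by
  field_simp
  ring

/-- **`Q_n` SOLVES LEGENDRE'S EQUATION on `(1, ∞)`**: `(1 − x²) Q″_n(x) − 2x Q′_n(x) + n(n + 1) Q_n(x) = 0`. -/
theorem legendre_ode_legQ2 (n : ℕ) {x : ℝ} (hx : 1 < x) :
    (1 - x ^ 2) * legQ2'' n x - 2 * x * legQ2' n x + (n : ℝ) * ((n : ℝ) + 1) * legQ2 n x = 0 := by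
  -- the kernel `u(t) = 1/(x − t)` and its derivatives on `[−1, 1]`
  set u : ℝ → ℝ := fun t => 1 / (x - t) with hu
  set u' : ℝ → ℝ := fun t => 1 / (x - t) ^ 2 with hu'
  set u'' : ℝ → ℝ := fun t => 2 / (x - t) ^ 3 with hu''
  have hne : ∀ t ∈ Icc (-1 : ℝ) 1, x - t ≠ 0 := fun t ht => by
    have : t < x := lt_of_le_of_lt ht.2 hx
    linarith
  have h1 : ∀ t ∈ Icc (-1 : ℝ) 1, HasDerivAt u (u' t) t := fun t ht => hasDerivAt_kernel (hne t ht)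
  have h2 : ∀ t ∈ Icc (-1 : ℝ) 1, HasDerivAt u' (u'' t) t := fun t ht => hasDerivAt_kernel' (hne t ht)
  have h3 : ContinuousOn u'' (Icc (-1 : ℝ) 1) := continuousOn_div_sub_pow continuous_const 3 hx
  -- row 422: `n(n + 1) ∫ u P_n = −∫ sturm u' u'' · P_n`
  have hsym := integral_mul_legP_eq_neg h1 h2 h3 n
  -- the three integrals of the equation
  have i1 := intervalIntegrable_div_sub (continuous_legP n) hx
  have i2 : IntervalIntegrable (fun t => legP n t / (x - t) ^ 2) volume (-1 : ℝ) 1 :=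
    (continuousOn_div_sub_pow (continuous_legP n) 2 hx).intervalIntegrable_of_Icc (by norm_num)
  have i3 : IntervalIntegrable (fun t => legP n t / (x - t) ^ 3) volume (-1 : ℝ) 1 :=
    (continuousOn_div_sub_pow (continuous_legP n) 3 hx).intervalIntegrable_of_Icc (by norm_num)
  -- the kernel identity integrated
  have hR : ∫ t in (-1 : ℝ)..1,
        legP n t * ((1 - t ^ 2) * u'' t - 2 * t * u' t) + (n : ℝ) * ((n : ℝ) + 1) * (u t * legP n t)
      = 2 * (1 - x ^ 2) * (∫ t in (-1 : ℝ)..1, legP n t / (x - t) ^ 3)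
        + 2 * x * (∫ t in (-1 : ℝ)..1, legP n t / (x - t) ^ 2)
        + (n : ℝ) * ((n : ℝ) + 1) * ∫ t in (-1 : ℝ)..1, legP n t / (x - t) := by
    rw [← intervalIntegral.integral_const_mul, ← intervalIntegral.integral_const_mul,
      ← intervalIntegral.integral_const_mul, ← integral_add (i3.const_mul _) (i2.const_mul _),
      ← integral_add ((i3.const_mul _).add (i2.const_mul _)) (i1.const_mul _)]
    refine integral_congr fun t ht => ?_
    rw [Set.uIcc_of_le (by norm_num)] at ht
    have hxt := hne t ht
    simp only [hu, hu', hu'']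
    field_simp
    ring
  have e : (1 - x ^ 2) * legQ2'' n x - 2 * x * legQ2' n x + (n : ℝ) * ((n : ℝ) + 1) * legQ2 n x
      = (1 / 2) * ∫ t in (-1 : ℝ)..1,
          legP n t * ((1 - t ^ 2) * u'' t - 2 * t * u' t) + (n : ℝ) * ((n : ℝ) + 1) * (u t * legP n t) := by
    simp only [legQ2, legQ2', legQ2'']
    rw [hR]
    ring
  have hst : ∫ t in (-1 : ℝ)..1, legP n t * ((1 - t ^ 2) * u'' t - 2 * t * u' t)
      = ∫ t in (-1 : ℝ)..1, T5SU11LegendreCoefficientDecay.sturm u' u'' t * legP n t := by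
    refine integral_congr fun t _ => ?_
    simp only [T5SU11LegendreCoefficientDecay.sturm]
    ring
  have ist : IntervalIntegrable (fun t => legP n t * ((1 - t ^ 2) * u'' t - 2 * t * u' t)) volume (-1 : ℝ) 1 := by
    have e2 : (fun t => legP n t * ((1 - t ^ 2) * u'' t - 2 * t * u' t))
        = fun t => T5SU11LegendreCoefficientDecay.sturm u' u'' t * legP n t := by
      funext t
      simp only [T5SU11LegendreCoefficientDecay.sturm]
      ring
    rw [e2]
    exact ((continuousOn_sturm h2 h3).mul (continuous_legP n).continuousOn).intervalIntegrable_of_Icc (by norm_num)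
  have iu : IntervalIntegrable (fun t => u t * legP n t) volume (-1 : ℝ) 1 :=
    ((continuousOn_div_sub continuous_const hx).mul (continuous_legP n).continuousOn).intervalIntegrable_of_Icc
      (by norm_num)
  rw [e, integral_add ist (iu.const_mul _), hst, intervalIntegral.integral_const_mul, hsym]
  ring

end Summit.Ventures.HodgeRepro2.T5SU11LegendreSecondKindODE
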